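import Mathlib
import HarnessLib
import Summits.ABC.ABC.Theorems.ReceptacleIdentity.Negative.TameLocalReceptacleResidueFreeLemmas
import Summits.ABC.ABC.Theorems.CompactBalanceTransfer.Negative.CuspWeightedResidueFree
import Literature.NumberTheory.QuadraticFields.JacobiCharacter

/-!
# Crux `TameLocalReceptacle` (stmt-ABC-14354): lemmas for the quadratic-local refutation

Bookkeeping used by `Theorems/TameLocalReceptacle/Negative/TameLocalReceptacleQuadraticLocal.lean`
(lead `prover-line-stmt-ABC-14354-0`):

* `sum_primeFactors_split3`, `sum_primeFactors_split2`, `sum_primeFactors_pow_eq` — splitting a sum of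
  a function of the prime over the prime support of a coprime product (the receptacle sum of a fixed
  triple is such a sum: for a fixed triple the summand is a function of the prime alone);
* `jacobiSym_mul_nat`, `jacobiSym_sq_nat`, `jacobiSym_of_dvd_of_add_eq`, `jacobiSym_pow_four` —
  Legendre/Jacobi symbol bookkeeping for residues taken in `ℕ` (`J(n mod p | p) = J(n | p)` is the
  tree's `Literature.NumberTheory.QuadraticFields.jacobiSym_natCast_mod`);
* valuation one-liners and `table_nonneg_of_four_le` (the lower window is `≥ 0` at exponent `≥ 4`);
* `abs_tableSum7_le` — the upper window bounds a residue-dependent table sum a priori (congruence to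
  equality is the tree's `CompactBalanceTransfer.Negative.eq_of_modEq_of_abs_le`).
-/

-- `Summit.<Summit>.<Problem>` is the mandated summit-side namespace (CONVENTIONS §2); for the
-- single-conjunct summit `ABC` the two coincide, so the duplicate `ABC.ABC` is deliberate.
set_option linter.dupNamespace false

namespace Summit.ABC.ABC.Theorems.TameLocalReceptacle

open NumberTheorySymbols Summit.ABC.ABC.Theorems.ReceptacleIdentity.Negative

/-! ### Splitting sums over prime supports -/

/-- A sum of a function of the prime over the primes of `abc` (pairwise coprime, positive) splits over
the three members. [folklore] -/
theorem sum_primeFactors_split3 (G : ℕ → ℤ) {a b c : ℕ} (ha : 0 < a) (hb : 0 < b) (hc : 0 < c)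
    (hab : Nat.Coprime a b) (hac : Nat.Coprime a c) (hbc : Nat.Coprime b c) :
    ∑ p ∈ (a * b * c).primeFactors, G p
      = ∑ p ∈ a.primeFactors, G p + ∑ p ∈ b.primeFactors, G p + ∑ p ∈ c.primeFactors, G p := by
  simpa using sum_primeFactors_triple (fun p _ _ _ => G p) ha hb hc hab hac hbc

/-- A sum of a function of the prime over the primes of a coprime product splits. [folklore] -/
theorem sum_primeFactors_split2 (G : ℕ → ℤ) {m n : ℕ} (hm : 0 < m) (hn : 0 < n)
    (hmn : Nat.Coprime m n) :
    ∑ p ∈ (m * n).primeFactors, G p = ∑ p ∈ m.primeFactors, G p + ∑ p ∈ n.primeFactors, G p := by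
  simpa using sum_primeFactors_mul_coprime (fun p _ => G p) hm hn hmn

/-- A sum over the primes of a prime power is one term. [folklore] -/
theorem sum_primeFactors_pow_eq (G : ℕ → ℤ) {p k : ℕ} (hp : p.Prime) (hk : k ≠ 0) :
    ∑ q ∈ (p ^ k).primeFactors, G q = G p := by
  rw [Nat.primeFactors_prime_pow hk hp, Finset.sum_singleton]

/-! ### Jacobi symbols of residues taken in `ℕ` -/

/-- Multiplicativity on natural numbers. [folklore] -/
theorem jacobiSym_mul_nat (m n p : ℕ) :
    J(((m * n : ℕ) : ℤ) | p) = J((m : ℤ) | p) * J((n : ℤ) | p) := by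
  push_cast; exact jacobiSym.mul_left _ _ _

/-- `J(m² | p) = 1` for `m` prime to `p`. [folklore] -/
theorem jacobiSym_sq_nat {m p : ℕ} (h : Nat.Coprime m p) : J(((m ^ 2 : ℕ) : ℤ) | p) = 1 := by
  have e : ((m ^ 2 : ℕ) : ℤ) = (m : ℤ) ^ 2 := by push_cast; ring
  rw [e]
  apply jacobiSym.sq_one'
  rw [Int.gcd_eq_natAbs]
  simpa using h

/-- `J(r⁴ | p) = 1` for `r` prime to `p`. [folklore] -/
theorem jacobiSym_pow_four {r p : ℕ} (h : Nat.Coprime r p) : J(((r ^ 4 : ℕ) : ℤ) | p) = 1 := by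
  have e : r ^ 4 = (r ^ 2) ^ 2 := by ring
  rw [e]
  exact jacobiSym_sq_nat (Nat.Coprime.pow_left 2 h)

/-- If `p ∣ x` and `x + y = k` then `J(y | p) = J(k | p)`. [folklore] -/
theorem jacobiSym_of_dvd_of_add_eq {p x y k : ℕ} (hp : p ∣ x) (h : x + y = k) :
    J((y : ℤ) | p) = J((k : ℤ) | p) := by
  apply jacobiSym.mod_left'
  have e : (k : ℤ) = (x : ℤ) + (y : ℤ) := by rw [← h]; push_cast; ring
  rw [e]
  obtain ⟨d, hd⟩ := hp
  subst hd
  push_cast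
  rw [Int.add_emod, Int.mul_emod_right, zero_add, Int.emod_emod_of_dvd _ (dvd_refl _)]

/-- If `p ∣ x` and `y + k = x`... variant: `k + y = x` with `p ∣ x` gives `J(y | p) = J(-k | p)`; we only
need the additive form above and this symmetric one: `p ∣ y`, `x + y = k` ⟹ `J(x | p) = J(k | p)`.
[folklore] -/
theorem jacobiSym_of_dvd_of_add_eq' {p x y k : ℕ} (hp : p ∣ y) (h : x + y = k) :
    J((x : ℤ) | p) = J((k : ℤ) | p) :=
  jacobiSym_of_dvd_of_add_eq hp (by rw [add_comm]; exact h)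

/-! ### Valuation one-liners -/

/-- No prime of one member divides a coprime partner. [folklore] -/
theorem not_dvd_of_coprime' {p m n : ℕ} (hp : p.Prime) (h : Nat.Coprime m n) (hm : p ∣ m) :
    ¬ p ∣ n := by
  intro hn
  have h1 : p ∣ Nat.gcd m n := Nat.dvd_gcd hm hn
  rw [Nat.Coprime.gcd_eq_one h] at h1
  exact hp.one_lt.ne' (Nat.dvd_one.mp h1)

/-- Valuation zero off the support. [folklore] -/
theorem factorization_eq_zero_of_not_dvd' {p n : ℕ} (h : ¬ p ∣ n) : n.factorization p = 0 :=
  Nat.factorization_eq_zero_of_not_dvd h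

/-- Valuation of a pure power of a prime. [folklore] -/
theorem factorization_prime_pow_self {p k : ℕ} (hp : p.Prime) : (p ^ k).factorization p = k := by
  rw [Nat.Prime.factorization_pow hp, Finsupp.single_eq_same]

/-- Valuation of `m * n` at a prime not dividing `m`. [folklore] -/
theorem factorization_mul_of_not_dvd_left {p m n : ℕ} (hm : m ≠ 0) (hn : n ≠ 0) (h : ¬ p ∣ m) :
    (m * n).factorization p = n.factorization p := by
  rw [Nat.factorization_mul hm hn, Finsupp.add_apply, Nat.factorization_eq_zero_of_not_dvd h, zero_add]

/-- Valuation of `m * n` at a prime not dividing `n`. [folklore] -/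
theorem factorization_mul_of_not_dvd_right {p m n : ℕ} (hm : m ≠ 0) (hn : n ≠ 0) (h : ¬ p ∣ n) :
    (m * n).factorization p = m.factorization p := by
  rw [Nat.factorization_mul hm hn, Finsupp.add_apply, Nat.factorization_eq_zero_of_not_dvd h, add_zero]

/-- The lower window is nonnegative at total exponent `≥ 4` when `ε < 2`. [folklore] -/
theorem table_nonneg_of_four_le {c₁ ε : ℝ} (hc₁ : 0 < c₁) (hε : ε < 2)
    {t : ℕ → ℕ → ℕ → ℕ → ℕ → ℕ → ℕ → ℤ}
    (hw : ∀ p i j k r s z : ℕ, p.Prime →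
      c₁ * (2 * ((i + j + k : ℕ) : ℝ) - 6 - ε) * Real.log p ≤ (t p i j k r s z : ℝ))
    {p a b c : ℕ} (hp : p.Prime) (h4 : 4 ≤ a + b + c) (r s z : ℕ) :
    0 ≤ (t p a b c r s z : ℝ) := by
  have h := hw p a b c r s z hp
  have h4' : (4 : ℝ) ≤ ((a + b + c : ℕ) : ℝ) := by exact_mod_cast h4
  have : 0 ≤ c₁ * (2 * ((a + b + c : ℕ) : ℝ) - 6 - ε) * Real.log p :=
    mul_nonneg (mul_nonneg hc₁.le (by linarith)) (Real.log_natCast_nonneg p)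
  linarith

/-! ### A-priori bound -/

/-- The upper window bounds a (residue-dependent) table sum over the primes of `abc` by a
table-independent quantity. [folklore] -/
theorem abs_tableSum7_le {t : ℕ → ℕ → ℕ → ℕ → ℕ → ℕ → ℕ → ℤ} {K : ℝ}
    (hKt : ∀ p i j k r s z : ℕ, p.Prime →
      |(t p i j k r s z : ℝ)| ≤ K * (((i + j + k : ℕ) : ℝ) + 1) * Real.log p)
    (a b c : ℕ) :
    |((∑ p ∈ (a * b * c).primeFactors, t p (a.factorization p) (b.factorization p)
        (c.factorization p) (a / p ^ a.factorization p % p) (b / p ^ b.factorization p % p)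
        (c / p ^ c.factorization p % p) : ℤ) : ℝ)| ≤
      ∑ p ∈ (a * b * c).primeFactors,
        K * (((a.factorization p + b.factorization p + c.factorization p : ℕ) : ℝ) + 1) *
          Real.log p := by
  push_cast
  refine (Finset.abs_sum_le_sum_abs _ _).trans (Finset.sum_le_sum fun p hp => ?_)
  have h := hKt p (a.factorization p) (b.factorization p) (c.factorization p)
    (a / p ^ a.factorization p % p) (b / p ^ b.factorization p % p)
    (c / p ^ c.factorization p % p) (Nat.prime_of_mem_primeFactors hp)
  push_cast at h
  exact h

end Summit.ABC.ABC.Theorems.TameLocalReceptacle
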